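import Literature.AnabelianGeometry.SemiGraphs.PSCGraphicProofs
import Literature.AnabelianGeometry.SemiGraphs.PSCCuspidalCriterionProofs
import HarnessLib

/-!
# [CombGC] Theorem 1.6 sub-DAG, rows T16-L06/L09: descent of Def. 1.4 (iv) from a Galois covering (Prop. 1.2 (ii))

Mochizuki, *A combinatorial version of the Grothendieck conjecture*, Tohoku Math. J. **59** (2007)
[CombGC], proof of Theorem 1.6 (ii), author's manuscript p. 14: "let us first observe that by
functoriality; Proposition 1.2, (ii); Proposition 1.5, (ii), it follows that we may always replace
`G`, `H` by finite étale `Π_G`- or `Π_H`-coverings that correspond via `α`."  This proof-only file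
makes the DESCENT half of that sentence kernel-precise over abc-iut-L3-t4's interface
(`PSCFundamentalGroup.lean` / `PSCGraphicity.lean`): the verticial (resp. edge-like, cuspidal,
nodal) subgroups of the covering `G_U` attached to an open normal `U ⊴ Π_G` are the `U ⊓ A`, `A`
verticial (resp. …) in `Π_G` (`IsVerticialIn U`, …); if `α : Π_G ⥲ Π_H` carries these, for `G_U`,
onto those for the corresponding covering `H_{α(U)}` — i.e. `α|_U` is group-theoretically verticial
(resp. …) for the pair of coverings — then `α` itself is group-theoretically verticial (resp. …),
PROVIDED the verticial and edge-like subgroups are commensurably terminal (Prop. 1.2 (ii),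
`VerticialEdgeLikeCommensurablyTerminal`, itself PROVED from separating coverings by abc-iut-w5-d183,
`PSCSeparatingCoveringsProofs2.lean`).  The point: `A` normalizes its open subgroup `U ⊓ A`, so
`α(A)` normalizes `α(U) ⊓ B`, an open subgroup of the verticial `B`; hence `α(A)` commensurates
`B`, i.e. `α(A) ⊆ C_{Π_H}(B) = B`, and symmetrically.

* `le_map_of_map_inf_eq`, `map_eq_of_map_inf_eq` — the group theory: for `α : Γ ≃* Γ'`, `U ⊴ Γ`
  of finite index, `A ≤ Γ` and `B ≤ Γ'` commensurably terminal, `α(U ⊓ A) = α(U) ⊓ B ⇒ α(A) = B`;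
* `isGroupTheoreticallyVerticial_of_level`, `isGroupTheoreticallyEdgeLike_of_level`,
  `isGroupTheoreticallyCuspidal_of_level`, `isGroupTheoreticallyNodal_of_level`
  (the last as the pair of transport statements) — descent from the covering level `U`;
* `isVerticialIn_level_of_isGroupTheoreticallyVerticial` (&c.) — the trivial ascent: a
  group-theoretically verticial `α` is so at every level.

Proof-only (0 defs); plain group theory (no topology beyond "open ⇒ finite index" in the compact
case); nothing here takes a side on [IUTchIII] Cor. 3.12.
[cite: MochizukiCombGC2007, Thm 1.6(ii) p.14] [cite: MochizukiCombGC2007, Prop 1.2(ii) p.8]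
-/

namespace Literature.AnabelianGeometry.SemiGraphs

namespace PSCDatum

open scoped Pointwise

universe u

/-! ### Group theory: commensurably terminal subgroups are recovered from a finite-index level -/

section GroupTheory

variable {Γ Γ' : Type u} [Group Γ] [Group Γ']

/-- `y B y⁻¹ = B` for `y ∈ B` (conjugation action). [cite: MochizukiCombGC2007, Prop 1.2(ii) p.8] -/
theorem conjAct_smul_eq_self_of_mem {B : Subgroup Γ} {y : Γ} (hy : y ∈ B) :
    ConjAct.toConjAct y • B = B := by
  ext z
  rw [Subgroup.mem_pointwise_smul_iff_inv_smul_mem, ConjAct.smul_def, ← ConjAct.toConjAct_inv,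
    ConjAct.ofConjAct_toConjAct, inv_inv]
  constructor
  · intro h
    have := B.mul_mem (B.mul_mem hy h) (B.inv_mem hy)
    simpa [mul_assoc] using this
  · intro h
    exact B.mul_mem (B.mul_mem (B.inv_mem hy) h) hy

/-- **Descent through a finite-index normal level, one inclusion.**  Let `α : Γ ≃* Γ'`, `U ⊴ Γ` of
finite index, `A ≤ Γ` commensurably terminal (`C_Γ(A) = A`), and suppose `α(U ⊓ A) = α(U) ⊓ B`.
Then `B ⊆ α(A)`: every `y ∈ B` normalizes `α(U) ⊓ B`, so `α⁻¹(y)` normalizes the finite-index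
subgroup `U ⊓ A` of `A`, hence commensurates `A`. [cite: MochizukiCombGC2007, Prop 1.2(ii) p.8] -/
theorem le_map_of_map_inf_eq (α : Γ ≃* Γ') {U A : Subgroup Γ} {B : Subgroup Γ'} [hUn : U.Normal]
    [hUf : U.FiniteIndex] (hA : Subgroup.Commensurable.commensurator A = A)
    (h : (U ⊓ A).map α.toMonoidHom = U.map α.toMonoidHom ⊓ B) : B ≤ A.map α.toMonoidHom := by
  intro y hy
  rw [Subgroup.mem_map_equiv]
  set x := α.symm y with hx
  rw [← hA, Subgroup.Commensurable.commensurator_mem_iff]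
  have hU'n : (U.map α.toMonoidHom).Normal := hUn.map _ α.surjective
  -- `y` normalizes `α(U) ⊓ B`, hence `x` normalizes `U ⊓ A`
  have hyD : ConjAct.toConjAct y • (U.map α.toMonoidHom ⊓ B) = U.map α.toMonoidHom ⊓ B := by
    rw [Subgroup.smul_inf, hU'n.conjAct, conjAct_smul_eq_self_of_mem hy]
  have hxD : ConjAct.toConjAct x • (U ⊓ A) = U ⊓ A := by
    apply Subgroup.map_injective (f := α.toMonoidHom) α.injective
    rw [map_conj_smul, h, ConjAct.ofConjAct_toConjAct]
    have hαx : α.toMonoidHom x = y := by rw [hx]; exact α.apply_symm_apply y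
    rw [hαx, hyD]
  -- `U ⊓ A = U ⊓ x A x⁻¹` lies in both `A` and `x A x⁻¹` with finite index
  have hxUA : U ⊓ ConjAct.toConjAct x • A = U ⊓ A := by
    rw [← hxD, Subgroup.smul_inf, hUn.conjAct]
  have hU : ∀ K : Subgroup Γ, U.relIndex K ≠ 0 := fun K h0 =>
    hUf.index_ne_zero (Nat.eq_zero_of_zero_dvd (h0 ▸ Subgroup.relIndex_dvd_index_of_normal U K))
  refine ⟨?_, ?_⟩
  · rw [← Subgroup.inf_relIndex_right]
    refine fun h0 => hU A (Subgroup.inf_relIndex_right U A ▸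
      Subgroup.relIndex_eq_zero_of_le_left (le_inf ?_ inf_le_right : U ⊓ A ≤ _ ⊓ A) h0)
    rw [← hxUA]
    exact inf_le_right
  · rw [← Subgroup.inf_relIndex_right]
    refine fun h0 => hU (ConjAct.toConjAct x • A)
      (Subgroup.inf_relIndex_right U _ ▸ Subgroup.relIndex_eq_zero_of_le_left
        (le_inf ?_ inf_le_right : U ⊓ ConjAct.toConjAct x • A ≤ A ⊓ _) h0)
    rw [hxUA]
    exact inf_le_right

/-- **Descent through a finite-index normal level.**  For `α : Γ ≃* Γ'`, `U ⊴ Γ` of finite index,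
and `A ≤ Γ`, `B ≤ Γ'` BOTH commensurably terminal: `α(U ⊓ A) = α(U) ⊓ B ⇒ α(A) = B`.
[cite: MochizukiCombGC2007, Prop 1.2(ii) p.8] -/
theorem map_eq_of_map_inf_eq (α : Γ ≃* Γ') {U A : Subgroup Γ} {B : Subgroup Γ'} [hUn : U.Normal]
    [hUf : U.FiniteIndex] (hA : Subgroup.Commensurable.commensurator A = A)
    (hB : Subgroup.Commensurable.commensurator B = B)
    (h : (U ⊓ A).map α.toMonoidHom = U.map α.toMonoidHom ⊓ B) : A.map α.toMonoidHom = B := by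
  refine le_antisymm ?_ (le_map_of_map_inf_eq α hA h)
  haveI : (U.map α.toMonoidHom).Normal := hUn.map _ α.surjective
  haveI : (U.map α.toMonoidHom).FiniteIndex := by
    refine ⟨?_⟩
    rw [show α.toMonoidHom = (α : Γ →* Γ') from rfl, Subgroup.index_map_equiv]
    exact hUf.index_ne_zero
  have hback : ∀ S : Subgroup Γ, (S.map α.toMonoidHom).map α.symm.toMonoidHom = S := fun S => by
    rw [Subgroup.map_map]
    convert Subgroup.map_id S
    ext z
    exact α.symm_apply_apply z
  have h' : (U.map α.toMonoidHom ⊓ B).map α.symm.toMonoidHom =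
      (U.map α.toMonoidHom).map α.symm.toMonoidHom ⊓ A := by
    rw [← h, hback, hback]
  have hle : A ≤ B.map α.symm.toMonoidHom := le_map_of_map_inf_eq α.symm hB h'
  rintro _ ⟨z, hz, rfl⟩
  have hz' := hle hz
  rw [Subgroup.mem_map_equiv, MulEquiv.symm_symm] at hz'
  exact hz'

end GroupTheory

/-! ### Descent of Def. 1.4 (iv) from the covering `G_U` -/

section Descent

variable {P : Type u} [Group P] [TopologicalSpace P]
variable {P' : Type u} [Group P'] [TopologicalSpace P']
variable (G : PSCDatum P) (H : PSCDatum P') (α : P ≃ₜ* P')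

/-- **"We may always replace `G`, `H` by finite étale coverings that correspond via `α`"**
([CombGC] p. 14), verticial case: if for an open normal `U ⊴ Π_G` of finite index the isomorphism
`α` carries the verticial subgroups `U ⊓ A` of `Π_{G_U} = U` onto the verticial subgroups of
`Π_{H_{α(U)}} = α(U)` and every one of the latter arises this way, and if verticial / edge-like
subgroups are commensurably terminal in `Π_G`, `Π_H` (Prop. 1.2 (ii)), then `α` is
group-theoretically verticial (Def. 1.4 (iv)). [cite: MochizukiCombGC2007, Thm 1.6(ii) p.14] -/
theorem isGroupTheoreticallyVerticial_of_level {U : Subgroup P} [U.Normal] [U.FiniteIndex]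
    (hG : G.VerticialEdgeLikeCommensurablyTerminal) (hH : H.VerticialEdgeLikeCommensurablyTerminal)
    (h₁ : ∀ D, G.IsVerticialIn U D →
      H.IsVerticialIn (U.map α.toMulEquiv.toMonoidHom) (D.map α.toMulEquiv.toMonoidHom))
    (h₂ : ∀ D', H.IsVerticialIn (U.map α.toMulEquiv.toMonoidHom) D' →
      ∃ D, G.IsVerticialIn U D ∧ D.map α.toMulEquiv.toMonoidHom = D') :
    G.IsGroupTheoreticallyVerticial H α := by
  refine ⟨fun A hA => ?_, fun B hB => ?_⟩
  · obtain ⟨B, hB, hEq⟩ := h₁ (U ⊓ A) ⟨A, hA, rfl⟩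
    rw [map_eq_of_map_inf_eq α.toMulEquiv (hG A (Or.inl hA)) (hH B (Or.inl hB)) hEq]
    exact hB
  · obtain ⟨D, ⟨A, hA, rfl⟩, hEq⟩ := h₂ (U.map α.toMulEquiv.toMonoidHom ⊓ B) ⟨B, hB, rfl⟩
    exact ⟨A, hA, map_eq_of_map_inf_eq α.toMulEquiv (hG A (Or.inl hA)) (hH B (Or.inl hB)) hEq⟩

/-- The same descent for edge-like subgroups: if `α` carries the edge-like subgroups of `Π_{G_U}`
onto those of `Π_{H_{α(U)}}` (both ways), then `α` is group-theoretically edge-like.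
[cite: MochizukiCombGC2007, Thm 1.6(ii) p.14] -/
theorem isGroupTheoreticallyEdgeLike_of_level {U : Subgroup P} [U.Normal] [U.FiniteIndex]
    (hG : G.VerticialEdgeLikeCommensurablyTerminal) (hH : H.VerticialEdgeLikeCommensurablyTerminal)
    (h₁ : ∀ D, G.IsEdgeLikeIn U D →
      H.IsEdgeLikeIn (U.map α.toMulEquiv.toMonoidHom) (D.map α.toMulEquiv.toMonoidHom))
    (h₂ : ∀ D', H.IsEdgeLikeIn (U.map α.toMulEquiv.toMonoidHom) D' →
      ∃ D, G.IsEdgeLikeIn U D ∧ D.map α.toMulEquiv.toMonoidHom = D') :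
    G.IsGroupTheoreticallyEdgeLike H α := by
  refine ⟨fun A hA => ?_, fun B hB => ?_⟩
  · obtain ⟨B, hB, hEq⟩ := h₁ (U ⊓ A) ⟨A, hA, rfl⟩
    rw [map_eq_of_map_inf_eq α.toMulEquiv (hG A (Or.inr hA)) (hH B (Or.inr hB)) hEq]
    exact hB
  · obtain ⟨D, ⟨A, hA, rfl⟩, hEq⟩ := h₂ (U.map α.toMulEquiv.toMonoidHom ⊓ B) ⟨B, hB, rfl⟩
    exact ⟨A, hA, map_eq_of_map_inf_eq α.toMulEquiv (hG A (Or.inr hA)) (hH B (Or.inr hB)) hEq⟩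

/-- The same descent for cuspidal subgroups: if `α` carries the cuspidal subgroups of `Π_{G_U}`
onto those of `Π_{H_{α(U)}}` (both ways), then `α` is group-theoretically cuspidal.
[cite: MochizukiCombGC2007, Thm 1.6(i) p.13] -/
theorem isGroupTheoreticallyCuspidal_of_level {U : Subgroup P} [U.Normal] [U.FiniteIndex]
    (hG : G.VerticialEdgeLikeCommensurablyTerminal) (hH : H.VerticialEdgeLikeCommensurablyTerminal)
    (h₁ : ∀ D, G.IsCuspidalIn U D →
      H.IsCuspidalIn (U.map α.toMulEquiv.toMonoidHom) (D.map α.toMulEquiv.toMonoidHom))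
    (h₂ : ∀ D', H.IsCuspidalIn (U.map α.toMulEquiv.toMonoidHom) D' →
      ∃ D, G.IsCuspidalIn U D ∧ D.map α.toMulEquiv.toMonoidHom = D') :
    G.IsGroupTheoreticallyCuspidal H α := by
  refine ⟨fun A hA => ?_, fun B hB => ?_⟩
  · obtain ⟨B, hB, hEq⟩ := h₁ (U ⊓ A) ⟨A, hA, rfl⟩
    rw [map_eq_of_map_inf_eq α.toMulEquiv (hG A (Or.inr (Or.inr hA)))
      (hH B (Or.inr (Or.inr hB))) hEq]
    exact hB
  · obtain ⟨D, ⟨A, hA, rfl⟩, hEq⟩ := h₂ (U.map α.toMulEquiv.toMonoidHom ⊓ B) ⟨B, hB, rfl⟩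
    exact ⟨A, hA, map_eq_of_map_inf_eq α.toMulEquiv (hG A (Or.inr (Or.inr hA)))
      (hH B (Or.inr (Or.inr hB))) hEq⟩

/-- The same descent for nodal subgroups (stated as the pair of transport properties): if `α`
carries the nodal subgroups of `Π_{G_U}` onto those of `Π_{H_{α(U)}}` (both ways), then `α` maps
each nodal subgroup of `Π_G` onto a nodal subgroup of `Π_H` and every nodal subgroup of `Π_H` so
arises. [cite: MochizukiCombGC2007, Thm 1.6(ii) p.14] -/
theorem isNodal_transport_of_level {U : Subgroup P} [U.Normal] [U.FiniteIndex]
    (hG : G.VerticialEdgeLikeCommensurablyTerminal) (hH : H.VerticialEdgeLikeCommensurablyTerminal)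
    (h₁ : ∀ D, G.IsNodalIn U D →
      H.IsNodalIn (U.map α.toMulEquiv.toMonoidHom) (D.map α.toMulEquiv.toMonoidHom))
    (h₂ : ∀ D', H.IsNodalIn (U.map α.toMulEquiv.toMonoidHom) D' →
      ∃ D, G.IsNodalIn U D ∧ D.map α.toMulEquiv.toMonoidHom = D') :
    (∀ A, G.IsNodal A → H.IsNodal (A.map α.toMulEquiv.toMonoidHom)) ∧
      ∀ B, H.IsNodal B → ∃ A, G.IsNodal A ∧ A.map α.toMulEquiv.toMonoidHom = B := by
  refine ⟨fun A hA => ?_, fun B hB => ?_⟩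
  · obtain ⟨B, hB, hEq⟩ := h₁ (U ⊓ A) ⟨A, hA, rfl⟩
    rw [map_eq_of_map_inf_eq α.toMulEquiv (hG A (Or.inr (Or.inl hA)))
      (hH B (Or.inr (Or.inl hB))) hEq]
    exact hB
  · obtain ⟨D, ⟨A, hA, rfl⟩, hEq⟩ := h₂ (U.map α.toMulEquiv.toMonoidHom ⊓ B) ⟨B, hB, rfl⟩
    exact ⟨A, hA, map_eq_of_map_inf_eq α.toMulEquiv (hG A (Or.inr (Or.inl hA)))
      (hH B (Or.inr (Or.inl hB))) hEq⟩

/-- **Open levels in a compact group.**  The verticial descent for an OPEN normal `U ⊴ Π_G` of the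
compact group `Π_G` (finite index being automatic). [cite: MochizukiCombGC2007, Thm 1.6(ii) p.14] -/
theorem isGroupTheoreticallyVerticial_of_open_level [IsTopologicalGroup P] [CompactSpace P]
    {U : Subgroup P} [U.Normal] (hU : IsOpen (U : Set P))
    (hG : G.VerticialEdgeLikeCommensurablyTerminal) (hH : H.VerticialEdgeLikeCommensurablyTerminal)
    (h₁ : ∀ D, G.IsVerticialIn U D →
      H.IsVerticialIn (U.map α.toMulEquiv.toMonoidHom) (D.map α.toMulEquiv.toMonoidHom))
    (h₂ : ∀ D', H.IsVerticialIn (U.map α.toMulEquiv.toMonoidHom) D' →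
      ∃ D, G.IsVerticialIn U D ∧ D.map α.toMulEquiv.toMonoidHom = D') :
    G.IsGroupTheoreticallyVerticial H α := by
  haveI : U.FiniteIndex := finiteIndex_of_isOpen U hU
  exact G.isGroupTheoreticallyVerticial_of_level H α hG hH h₁ h₂

/-! ### The trivial ascent: `α` group-theoretically verticial ⇒ so at every level -/

/-- If `α` is group-theoretically verticial, then at every level `U` it carries the verticial
subgroups `U ⊓ A` of `Π_{G_U}` onto the verticial subgroups of `Π_{H_{α(U)}}`, and every one of
the latter arises ("coverings that correspond via `α`", p. 14).
[cite: MochizukiCombGC2007, Thm 1.6(ii) p.14] -/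
theorem isVerticialIn_level_of_isGroupTheoreticallyVerticial (h : G.IsGroupTheoreticallyVerticial H α)
    (U : Subgroup P) :
    (∀ D, G.IsVerticialIn U D →
      H.IsVerticialIn (U.map α.toMulEquiv.toMonoidHom) (D.map α.toMulEquiv.toMonoidHom)) ∧
    ∀ D', H.IsVerticialIn (U.map α.toMulEquiv.toMonoidHom) D' →
      ∃ D, G.IsVerticialIn U D ∧ D.map α.toMulEquiv.toMonoidHom = D' := by
  have hinj : Function.Injective α.toMulEquiv.toMonoidHom := α.injective
  refine ⟨?_, ?_⟩
  · rintro D ⟨A, hA, rfl⟩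
    exact ⟨A.map α.toMulEquiv.toMonoidHom, h.1 A hA, Subgroup.map_inf U A _ hinj⟩
  · rintro D' ⟨B, hB, rfl⟩
    obtain ⟨A, hA, rfl⟩ := h.2 B hB
    exact ⟨U ⊓ A, ⟨A, hA, rfl⟩, Subgroup.map_inf U A _ hinj⟩

/-- If `α` is group-theoretically edge-like, then so it is at every level (edge-like subgroups of
the coverings correspond via `α`). [cite: MochizukiCombGC2007, Thm 1.6(ii) p.14] -/
theorem isEdgeLikeIn_level_of_isGroupTheoreticallyEdgeLike (h : G.IsGroupTheoreticallyEdgeLike H α)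
    (U : Subgroup P) :
    (∀ D, G.IsEdgeLikeIn U D →
      H.IsEdgeLikeIn (U.map α.toMulEquiv.toMonoidHom) (D.map α.toMulEquiv.toMonoidHom)) ∧
    ∀ D', H.IsEdgeLikeIn (U.map α.toMulEquiv.toMonoidHom) D' →
      ∃ D, G.IsEdgeLikeIn U D ∧ D.map α.toMulEquiv.toMonoidHom = D' := by
  have hinj : Function.Injective α.toMulEquiv.toMonoidHom := α.injective
  refine ⟨?_, ?_⟩
  · rintro D ⟨A, hA, rfl⟩
    exact ⟨A.map α.toMulEquiv.toMonoidHom, h.1 A hA, Subgroup.map_inf U A _ hinj⟩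
  · rintro D' ⟨B, hB, rfl⟩
    obtain ⟨A, hA, rfl⟩ := h.2 B hB
    exact ⟨U ⊓ A, ⟨A, hA, rfl⟩, Subgroup.map_inf U A _ hinj⟩

/-- If `α` is group-theoretically cuspidal, then so it is at every level (cuspidal subgroups of
the coverings correspond via `α`). [cite: MochizukiCombGC2007, Thm 1.6(i) p.13] -/
theorem isCuspidalIn_level_of_isGroupTheoreticallyCuspidal (h : G.IsGroupTheoreticallyCuspidal H α)
    (U : Subgroup P) :
    (∀ D, G.IsCuspidalIn U D →
      H.IsCuspidalIn (U.map α.toMulEquiv.toMonoidHom) (D.map α.toMulEquiv.toMonoidHom)) ∧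
    ∀ D', H.IsCuspidalIn (U.map α.toMulEquiv.toMonoidHom) D' →
      ∃ D, G.IsCuspidalIn U D ∧ D.map α.toMulEquiv.toMonoidHom = D' := by
  have hinj : Function.Injective α.toMulEquiv.toMonoidHom := α.injective
  refine ⟨?_, ?_⟩
  · rintro D ⟨A, hA, rfl⟩
    exact ⟨A.map α.toMulEquiv.toMonoidHom, h.1 A hA, Subgroup.map_inf U A _ hinj⟩
  · rintro D' ⟨B, hB, rfl⟩
    obtain ⟨A, hA, rfl⟩ := h.2 B hB
    exact ⟨U ⊓ A, ⟨A, hA, rfl⟩, Subgroup.map_inf U A _ hinj⟩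

end Descent

end PSCDatum

end Literature.AnabelianGeometry.SemiGraphs
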